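/-
Copyright (c) 2026 the pub-hodgecm-mathlib formalisation cell (harness21).  Prover seat hodgecm-mathlib-B-p14 (g33), 2026-09-01.  Road «W′» = «R1LL-WILD»
(architect A-p16 (g28), census W′-v1 §5: «(W′2) C»): the weighted unfolding on a PRODUCT `G × A` read on the vertices of a `G′`-set through `e : G →* G′`
— the `H_v = U(Φ₂)_v × U(Φ₁)_v → tree` shape of the rank-one road, generic half.
-/
import Literature.NumberTheory.Automorphic.OrbitalIntegralFixedPointWeightedAction   -- ★ p843922∕p843957 (this seat): the vertex readings + shell sums
import Literature.GroupTheory.CosetSpaceProdTop                                     -- ★ I-7a p843352 (A-p16): `finsum_mem_fixedBy_quotient_prod_top_eq`, `exists_equiv_quotient_prod_top`, `image_fixedBy_prod_eq`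
import HarnessLib

/-!
# The weighted unfolding on `G × A`, read on the vertices of a `G′`-set through `e : G →* G′`
# `∫_{G×A} φ(h x h⁻¹) dν(h) = ν(K × A) · Σ_{v ∈ Fix_W(e x.1)} val v`

Topic `NumberTheory/Automorphic`; namespace `Literature.NumberTheory.Automorphic`.  THEOREMS ONLY (no definition, no instance, no notation, no named fact, no `sorry`);
kernel lane.  Cell `pub/hodgecm-mathlib`, crux H413 = stmt-HodgeConjecture-24833; road «W′» = «R1LL-WILD» (architect A-p16 (g28), census W′-v1 §1∕§5), brick
(W′2) C, GENERIC HALF: the composite of ★ I-7a (`(G × A) ⧸ (K × A) = G ⧸ K`, A-p16) with this seat's ★ (W′2) vertex readings (`FixedPointsOrbitMapTransport`,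
`FixedPointsShellValueLaw`, `OrbitalIntegralFixedPointWeightedAction`) along a homomorphism `e : G →* G′` into the group that acts on the tree — the exact shape of
★ I-7 `integral_conj_eq_smul_finsum_fixedBy_prod_congr` (coset currency) with the target now the fixed VERTICES.  At `G × A := H_v = U(Φ₂)(L⁺_v) × U(Φ₁)(L⁺_v)`,
`e := E₂` (one-place model) and `act := ρ_w` (★ `rhoVertexActPlace`, ROAD W) this is the unfolding socket of the END-WILD (the CM dress is the sibling file, cut when
(W′0) has pinned the level).
HONEST LABEL: HC_CM is proved only modulo the cell's remaining named inputs (hLiu418, h413) until rung 0 closes; generic measure bookkeeping, print cited for orientation.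

THE MATHEMATICS [Rogawski1990 §4.9 p. 54; Kottwitz1986 §3; LabesseLanglands1979 §2 p. 8].  `G × A` with a right-invariant `ν`, `K ≤ G` with `K × A` open of finite
mass, `φ : G × A → E` supported in `K × A` and `Ad(K × A)`-invariant, `x = (γ, α)`.  `G` acts on `W` through `e : G →* G′` and `act : G′ → W → W` with ONE orbit of
`x₀` and `K = Stab_G(x₀)` (`g ∈ K ↔ e(g)·x₀ = x₀`).  Then (★ I-3 on `G × A`, ★ I-7a to `G ⧸ K`, ★ (W′2) to the vertices, composite action `g ↦ act (e g)`):
  `∫ φ(h x h⁻¹) dν(h) = ν(K × A) · Σ_{v ∈ Fix_W(e γ)} val v`   for any value law `φ (g⁻¹ γ g, α) = val (e(g)·x₀)` at the fixed vertices,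
and under a shell decomposition through the centraliser (`e(t · r_{d v})·x₀ = v`, `t γ = γ t`) the SHELL SUM
  `∫ φ(h x h⁻¹) dν(h) = ν(K × A) · Σ_{i ≤ N} #{v ∈ Fix_W(e γ) | d v = i} • φ (r_i⁻¹ γ r_i, α)`.

* §1 (pure) `finsum_mem_fixedBy_quotient_prod_conj_eq_finsum_fixedPoints_of_vertexAction`, `…_eq_sum_ncard_shell_smul_…`, `finite_fixedBy_quotient_prod_iff_of_vertexAction`.
* §2 (integral) **`integral_conj_eq_smul_finsum_fixedPoints_of_vertexAction_prod`**, **`integral_conj_eq_smul_sum_shells_of_vertexAction_prod`**.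

## References
* [Rogawski1990] J. D. Rogawski, *Automorphic Representations of Unitary Groups in Three Variables*, Ann. of Math. Stud. 123 (1990): §4.9 p. 54.
* [Kottwitz1986] R. E. Kottwitz, *Base change for unit elements of Hecke algebras*, Compositio Math. 60 (1986): §3.
* [LabesseLanglands1979] J.-P. Labesse, R. P. Langlands, *L-indistinguishability for SL(2)*, Canad. J. Math. 31 (1979): §2 p. 8.
* [Laumon1995] G. Laumon, *Cohomology of Drinfeld Modular Varieties* I (1996): Lemma (5.3.2) p. 136.
-/

set_option autoImplicit false

noncomputable section

open MeasureTheory Measure Topology Filter Set Function MulAction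
open Literature.GroupTheory
open scoped ENNReal NNReal Pointwise

namespace Literature.NumberTheory.Automorphic

/-! ## §1 Pure: `(G × A) ⧸ (K × A)` fixed-point sums read on the vertices through `e : G →* G′` -/

section Pure

variable {G A G' W : Type*} [Group G] [Group A] [Group G']
  (act : G' → W → W) (act_one : ∀ x : W, act 1 x = x) (act_mul : ∀ (g h : G') (x : W), act (g * h) x = act g (act h x))
  (e : G →* G') {x₀ : W} (hV : ∀ x : W, ∃ g : G, act (e g) x₀ = x) (K : Subgroup G) (hK : ∀ g : G, g ∈ K ↔ act (e g) x₀ = x₀)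
  (γ : G) (α : A)

include act_one in
/-- Bookkeeping (private): the composite action `g ↦ act (e g)` fixes everything at `g = 1`. [folklore] -/
private theorem act_map_one (x : W) : act (e 1) x = x := by rw [map_one, act_one]

include act_mul in
/-- Bookkeeping (private): the composite action `g ↦ act (e g)` is multiplicative. [folklore] -/
private theorem act_map_mul (g h : G) (x : W) : act (e (g * h)) x = act (e g) (act (e h) x) := by rw [map_mul, act_mul]

/-- Bookkeeping (private): an `Ad(K × A)`-invariant `φ` is `Ad K`-invariant in the first variable. [folklore] -/
private theorem conj_invariant_fst {E : Type*} (φ : G × A → E) (hφK : ∀ k ∈ K.prod (⊤ : Subgroup A), ∀ y : G × A, φ (k * y * k⁻¹) = φ y)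
    (k : G) (hk : k ∈ K) (y : G) : φ (k * y * k⁻¹, α) = φ (y, α) := by
  have h := hφK (k, 1) (Subgroup.mem_prod.2 ⟨hk, Subgroup.mem_top _⟩) (y, α)
  rwa [Prod.inv_mk, Prod.mk_mul_mk, Prod.mk_mul_mk, inv_one, one_mul, mul_one] at h

include act_one act_mul hV hK in
/-- **`(G × A) ⧸ (K × A)` FIXED-POINT SUM READ ON THE VERTICES** (value-law form): for `φ` invariant under `Ad(K × A)` and a value law
`φ (g⁻¹ γ g, α) = val (e(g)·x₀)` at the `e γ`-fixed vertices, `Σᶠ_{q ∈ Fix_{(γ,α)}((G × A) ⧸ (K × A))} φ (q.out⁻¹ (γ, α) q.out) = Σᶠ_{v ∈ Fix_W(e γ)} val v` —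
★ I-7a `finsum_mem_fixedBy_quotient_prod_top_eq` then ★ `finsum_mem_fixedBy_quotient_conj_eq_finsum_fixedPoints_of_vertexAction` for the composite action `g ↦ act (e g)`.
[cite: Kottwitz1986, §3] [cite: Rogawski1990, §4.9 p. 54] -/
theorem finsum_mem_fixedBy_quotient_prod_conj_eq_finsum_fixedPoints_of_vertexAction {E : Type*} [AddCommMonoid E] (φ : G × A → E)
    (hφK : ∀ k ∈ K.prod (⊤ : Subgroup A), ∀ y : G × A, φ (k * y * k⁻¹) = φ y) (val : W → E)
    (hval : ∀ g : G, act (e γ) (act (e g) x₀) = act (e g) x₀ → φ (g⁻¹ * γ * g, α) = val (act (e g) x₀)) :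
    ∑ᶠ q ∈ fixedBy ((G × A) ⧸ K.prod (⊤ : Subgroup A)) (γ, α), φ (q.out⁻¹ * (γ, α) * q.out) = ∑ᶠ v ∈ {v : W | act (e γ) v = v}, val v := by
  rw [finsum_mem_fixedBy_quotient_prod_top_eq K φ hφK γ α]
  exact finsum_mem_fixedBy_quotient_conj_eq_finsum_fixedPoints_of_vertexAction (fun g : G => act (e g)) (act_map_one act act_one e)
    (act_map_mul act act_mul e) hV K hK γ (fun y : G => φ (y, α)) val hval

include act_one act_mul hV hK in
/-- **`(G × A) ⧸ (K × A)` FIXED-POINT SUM AS A SHELL SUM**: under a shell decomposition of the `e γ`-fixed vertices through the centraliser of `γ` (`e(t · r_{d v})·x₀ = v`,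
`t γ = γ t`), with finitely many fixed vertices all of shell index `≤ N`,
`Σᶠ_{q ∈ Fix_{(γ,α)}} φ (q.out⁻¹ (γ, α) q.out) = Σ_{i ≤ N} #{v ∈ Fix_W(e γ) | d v = i} • φ (r_i⁻¹ γ r_i, α)` (★ `FixedPointsShellValueLaw`).
[cite: LabesseLanglands1979, §2 p. 8] [cite: Kottwitz1986, §3] -/
theorem finsum_mem_fixedBy_quotient_prod_conj_eq_sum_ncard_shell_smul_of_vertexAction {E : Type*} [AddCommMonoid E] (φ : G × A → E)
    (hφK : ∀ k ∈ K.prod (⊤ : Subgroup A), ∀ y : G × A, φ (k * y * k⁻¹) = φ y) (d : W → ℕ) (r : ℕ → G) (N : ℕ)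
    (hshell : ∀ v : W, act (e γ) v = v → ∃ t : G, t * γ = γ * t ∧ act (e (t * r (d v))) x₀ = v)
    (hfin : {v : W | act (e γ) v = v}.Finite) (hN : ∀ v : W, act (e γ) v = v → d v ≤ N) :
    ∑ᶠ q ∈ fixedBy ((G × A) ⧸ K.prod (⊤ : Subgroup A)) (γ, α), φ (q.out⁻¹ * (γ, α) * q.out) =
      ∑ i ∈ Finset.range (N + 1), {v : W | act (e γ) v = v ∧ d v = i}.ncard • φ ((r i)⁻¹ * γ * r i, α) := by
  rw [finsum_mem_fixedBy_quotient_prod_top_eq K φ hφK γ α]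
  exact finsum_mem_fixedBy_quotient_conj_eq_sum_ncard_shell_smul_of_vertexAction (fun g : G => act (e g)) (act_map_one act act_one e)
    (act_map_mul act act_mul e) K hK γ hV (fun y : G => φ (y, α)) (conj_invariant_fst K α φ hφK) d r N hshell hfin hN

include act_one act_mul hV hK in
/-- Finitely many `(γ, α)`-fixed cosets in `(G × A) ⧸ (K × A)` iff finitely many `e γ`-fixed vertices. [cite: Kottwitz1986, §3] -/
theorem finite_fixedBy_quotient_prod_iff_of_vertexAction :
    (fixedBy ((G × A) ⧸ K.prod (⊤ : Subgroup A)) (γ, α)).Finite ↔ {v : W | act (e γ) v = v}.Finite := by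
  obtain ⟨Φ, -, hΦ⟩ := exists_equiv_quotient_prod_top (A := A) K
  rw [← Set.finite_image_iff Φ.injective.injOn, image_fixedBy_prod_eq K Φ hΦ γ α]
  exact finite_fixedBy_quotient_iff_of_vertexAction (fun g : G => act (e g)) (act_map_one act act_one e) (act_map_mul act act_mul e) hV K hK γ

end Pure

/-! ## §2 The orbital integral on `G × A` as a sum over the fixed vertices ∕ a shell sum -/

section Integral

variable {G A G' W : Type*} [Group G] [Group A] [Group G'] [TopologicalSpace G] [TopologicalSpace A]
  [IsTopologicalGroup G] [IsTopologicalGroup A] [MeasurableSpace (G × A)] [BorelSpace (G × A)]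
  (ν : Measure (G × A)) [ν.IsMulRightInvariant]
  {E : Type*} [NormedAddCommGroup E] [NormedSpace ℝ E] [CompleteSpace E]
  (act : G' → W → W) (act_one : ∀ x : W, act 1 x = x) (act_mul : ∀ (g h : G') (x : W), act (g * h) x = act g (act h x))
  (e : G →* G') {x₀ : W} (hV : ∀ x : W, ∃ g : G, act (e g) x₀ = x) (K : Subgroup G) (hK : ∀ g : G, g ∈ K ↔ act (e g) x₀ = x₀)

include act_one act_mul hV hK in
/-- **THE ORBITAL INTEGRAL ON `G × A` AS A SUM OVER THE FIXED VERTICES**: `K × A` open of finite mass, `φ` supported in `K × A` and `Ad(K × A)`-invariant, finitely many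
`e x.1`-fixed vertices, and a value law `φ (g⁻¹ x.1 g, x.2) = val (e(g)·x₀)` at them:
`∫ φ(h x h⁻¹) dν(h) = ν(K × A) · Σᶠ_{v ∈ Fix_W(e x.1)} val v` — the vertex twin of ★ I-7 `integral_conj_eq_smul_finsum_fixedBy_prod_congr`.
[cite: Rogawski1990, §4.9 p. 54] [cite: Kottwitz1986, §3] [cite: Laumon1995, Lemma (5.3.2) p. 136] -/
theorem integral_conj_eq_smul_finsum_fixedPoints_of_vertexAction_prod
    (hKo : IsOpen ((K.prod (⊤ : Subgroup A) : Subgroup (G × A)) : Set (G × A))) (hKν : ν ((K.prod (⊤ : Subgroup A) : Subgroup (G × A)) : Set (G × A)) ≠ ⊤)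
    (x : G × A) (φ : G × A → E) (hφ : support φ ⊆ ((K.prod (⊤ : Subgroup A) : Subgroup (G × A)) : Set (G × A)))
    (hφK : ∀ k ∈ K.prod (⊤ : Subgroup A), ∀ y : G × A, φ (k * y * k⁻¹) = φ y)
    (hfin : {v : W | act (e x.1) v = v}.Finite) (val : W → E)
    (hval : ∀ g : G, act (e x.1) (act (e g) x₀) = act (e g) x₀ → φ (g⁻¹ * x.1 * g, x.2) = val (act (e g) x₀)) :
    ∫ h, φ (h * x * h⁻¹) ∂ν = ν.real ((K.prod (⊤ : Subgroup A) : Subgroup (G × A)) : Set (G × A)) • ∑ᶠ v ∈ {v : W | act (e x.1) v = v}, val v := by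
  obtain ⟨γ, α⟩ := x
  rw [integral_conj_eq_smul_finsum_fixedBy (γ, α) (K.prod (⊤ : Subgroup A)) ν hKo hKν φ hφ hφK
      ((finite_fixedBy_quotient_prod_iff_of_vertexAction act act_one act_mul e hV K hK γ α).2 hfin),
    finsum_mem_fixedBy_quotient_prod_conj_eq_finsum_fixedPoints_of_vertexAction act act_one act_mul e hV K hK γ α φ hφK val hval]

include act_one act_mul hV hK in
/-- **THE ORBITAL INTEGRAL ON `G × A` AS A SHELL SUM** (Labesse–Langlands' `∫_{T∖G̃} f(x̃⁻¹ γ x̃) dx̃ = Σ_m C_m(γ) f(α_m⁻¹ γ α_m)`): under a shell decomposition of the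
`e x.1`-fixed vertices through the centraliser of `x.1`,
`∫ φ(h x h⁻¹) dν(h) = ν(K × A) · Σ_{i ≤ N} #{v ∈ Fix_W(e x.1) | d v = i} • φ (r_i⁻¹ x.1 r_i, x.2)`.
[cite: LabesseLanglands1979, §2 p. 8] [cite: Rogawski1990, §4.9 p. 54] [cite: Kottwitz1986, §3] -/
theorem integral_conj_eq_smul_sum_shells_of_vertexAction_prod
    (hKo : IsOpen ((K.prod (⊤ : Subgroup A) : Subgroup (G × A)) : Set (G × A))) (hKν : ν ((K.prod (⊤ : Subgroup A) : Subgroup (G × A)) : Set (G × A)) ≠ ⊤)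
    (x : G × A) (φ : G × A → E) (hφ : support φ ⊆ ((K.prod (⊤ : Subgroup A) : Subgroup (G × A)) : Set (G × A)))
    (hφK : ∀ k ∈ K.prod (⊤ : Subgroup A), ∀ y : G × A, φ (k * y * k⁻¹) = φ y)
    (hfin : {v : W | act (e x.1) v = v}.Finite) (d : W → ℕ) (r : ℕ → G) (N : ℕ)
    (hshell : ∀ v : W, act (e x.1) v = v → ∃ t : G, t * x.1 = x.1 * t ∧ act (e (t * r (d v))) x₀ = v)
    (hN : ∀ v : W, act (e x.1) v = v → d v ≤ N) :
    ∫ h, φ (h * x * h⁻¹) ∂ν =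
      ν.real ((K.prod (⊤ : Subgroup A) : Subgroup (G × A)) : Set (G × A)) •
        ∑ i ∈ Finset.range (N + 1), {v : W | act (e x.1) v = v ∧ d v = i}.ncard • φ ((r i)⁻¹ * x.1 * r i, x.2) := by
  obtain ⟨γ, α⟩ := x
  rw [integral_conj_eq_smul_finsum_fixedBy (γ, α) (K.prod (⊤ : Subgroup A)) ν hKo hKν φ hφ hφK
      ((finite_fixedBy_quotient_prod_iff_of_vertexAction act act_one act_mul e hV K hK γ α).2 hfin),
    finsum_mem_fixedBy_quotient_prod_conj_eq_sum_ncard_shell_smul_of_vertexAction act act_one act_mul e hV K hK γ α φ hφK d r N hshell hfin hN]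

end Integral

end Literature.NumberTheory.Automorphic

end
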